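import Summits.QuantumFields.YangMills.Theorems.LatticeGapOnTrajectory.Negative.ZeroCoupling
import Summits.QuantumFields.YangMills.Theses.ParabolicTrajectory
import Literature.Probability.LatticeModels.GibbsSpecification
import Literature.MathematicalPhysics.QuantumFieldTheory.YangMillsOS
import Mathlib.Probability.Moments.Covariance
import Summits.QuantumFields.YangMills.Theorems.ParabolicTrajectoryLatticeGapOnTrajectoryDefs

/-!
# Route `ParabolicTrajectory`, crux `LatticeGapOnTrajectory` (stmt-QuantumFields-10523), line `orbit-kantorovich-finite-size`: stub `stub_smoothingToGap` — deployment on the symmetric torus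

Given the Dobrushin–Shlosman/Kantorovich ENGINE (`KREngine`), the torus frames (`TorusFramesExist`), the
window-averaging toolkit (`SpecificationTower`), the DLR description of Wilson's torus measure
(`WilsonTorusDLR`) and the orbit–Kantorovich windows along the scheme (`OrbitKRWindowsAlong`), the
crux's lattice half `HasLatticeMassGap r sch Δ` holds with `Δ = κ(n₀, γ₀, 1) / (4t)`.

* §A `cdist`: component bound, symmetry, `cdist x x = 0`, triangle inequality (`ZMod.valMinAbs`).
* §B `dependsOn_of_cellwise`: single-cell invariance on a finite set of cells ⇒ dependence off those cells.
* §C `abs_corr_le_two_mul`: the trivial bound `2‖f‖‖g‖` (near case).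
* §D `abs_corr_le_far`: the TOWER identity `cov(f, g) = cov(γ_{W_A} f, γ_{W_B} g)` and the engine (far case),
  for an abstract specification read on cells.
* §E `abs_latticeConnectedCorr_le`: one torus, one time separation: frames adapted to the two supports,
  near/far split, exponent bookkeeping.
* §F `stub_smoothingToGap`: the eventualities in `k` and the `k`-uniform constant.
-/


/-! This is the HELPERS half (G-blind: coarse-distance lemmas, cellwise dependence, the abstract tower identity + engine
`abs_corr_le_far`, registered via `workitem stub-add`); the stub itself is in `…StubSmoothingToGap.lean`, which imports this file. -/

namespace Summit.QuantumFields.YangMills.Cruxes.LatticeGapOnTrajectory.OrbitKantorovichFiniteSize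

open scoped BigOperators Topology ENNReal ProbabilityTheory
open Filter MeasureTheory
open Literature.Probability.LatticeModels (Specification IsSpecification IsGibbsMeasure glueWith)
open Literature.MathematicalPhysics.QuantumFieldTheory
open Literature.MathematicalPhysics.QuantumLattice
open Summit.QuantumFields.YangMills.Theorems.LatticeGapOnTrajectory.Negative

noncomputable section

/-! ### §A The coarse distance -/

section CDist

variable {μ : Fin 4 → ℕ}

/-- Each axis component of the coarse distance is bounded by the coarse distance. -/
theorem natAbs_valMinAbs_sub_le_cdist (x y : CoarseIdx μ) (i : Fin 4) :
    ((x i - y i).valMinAbs).natAbs ≤ cdist x y :=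
  Finset.le_sup (f := fun j : Fin 4 => ((x j - y j).valMinAbs).natAbs) (Finset.mem_univ i)

/-- The coarse distance is symmetric. -/
theorem cdist_comm (x y : CoarseIdx μ) : cdist x y = cdist y x := by
  unfold cdist
  refine congrArg _ (funext fun i => ?_)
  rw [← neg_sub (y i) (x i), ZMod.natAbs_valMinAbs_neg]

/-- The coarse distance of a label to itself vanishes. -/
theorem cdist_self (x : CoarseIdx μ) : cdist x x = 0 :=
  Nat.eq_zero_of_le_zero (Finset.sup_le fun i _ => by simp)

/-- Triangle inequality for the coarse distance (axis by axis, `ZMod.natAbs_valMinAbs_add_le`). -/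
theorem cdist_triangle (x y z : CoarseIdx μ) : cdist x z ≤ cdist x y + cdist y z := by
  refine Finset.sup_le fun i _ => ?_
  have h : x i - z i = (x i - y i) + (y i - z i) := by abel
  calc ((x i - z i).valMinAbs).natAbs
      = (((x i - y i) + (y i - z i)).valMinAbs).natAbs := by rw [h]
    _ ≤ ((x i - y i).valMinAbs + (y i - z i).valMinAbs).natAbs := ZMod.natAbs_valMinAbs_add_le _ _
    _ ≤ ((x i - y i).valMinAbs).natAbs + ((y i - z i).valMinAbs).natAbs := Int.natAbs_add_le _ _
    _ ≤ cdist x y + cdist y z :=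
        add_le_add (natAbs_valMinAbs_sub_le_cdist x y i) (natAbs_valMinAbs_sub_le_cdist y z i)

end CDist

/-! ### §B Dependence from cellwise invariance -/

/-- If changing a configuration on any single cell of `Far` does not change `P`, then `P` depends only on
the sites outside the cells of `Far` (finite induction over the set of cells already changed). -/
theorem dependsOn_of_cellwise {V ι S α : Type*} [DecidableEq ι] (cell : V → ι) (P : (V → S) → α)
    (Far : Finset ι)
    (h : ∀ y ∈ Far, ∀ σ τ : V → S, (∀ v, cell v ≠ y → σ v = τ v) → P σ = P τ) :
    DependsOn P {v | cell v ∉ Far} := by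
  intro σ τ hστ
  have key : ∀ s : Finset ι, s ⊆ Far → P (fun v => if cell v ∈ s then τ v else σ v) = P σ := by
    intro s
    induction s using Finset.induction_on with
    | empty => intro; simp
    | insert y s hy ih =>
      intro hs
      rw [← ih fun x hx => hs (Finset.mem_insert_of_mem hx)]
      refine h y (hs (Finset.mem_insert_self y s)) _ _ fun v hv => ?_
      have hiff : cell v ∈ insert y s ↔ cell v ∈ s := by
        rw [Finset.mem_insert]
        exact ⟨fun h' => h'.resolve_left hv, Or.inr⟩
      simp only [hiff]
  have hfin : (fun v => if cell v ∈ Far then τ v else σ v) = τ := by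
    funext v
    split_ifs with hv
    · rfl
    · exact hστ v hv
  calc P σ = P (fun v => if cell v ∈ Far then τ v else σ v) := (key Far (Finset.Subset.refl _)).symm
    _ = P τ := by rw [hfin]

/-! ### §C The near case: the trivial bound -/

/-- Trivial bound on a connected correlation of two bounded functions under a probability measure:
`|∫ f g − ∫ f ∫ g| ≤ 2 ‖f‖_∞ ‖g‖_∞`. -/
theorem abs_corr_le_two_mul {Ω : Type*} [MeasurableSpace Ω] (ν : Measure Ω) [IsProbabilityMeasure ν]
    {f g : Ω → ℝ} {CA CB : ℝ} (hfb : ∀ σ, |f σ| ≤ CA) (hgb : ∀ σ, |g σ| ≤ CB) :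
    |(∫ σ, f σ * g σ ∂ν) - (∫ σ, f σ ∂ν) * ∫ σ, g σ ∂ν| ≤ 2 * (CA * CB) := by
  have key : ∀ {h : Ω → ℝ} {C : ℝ}, (∀ σ, |h σ| ≤ C) → |∫ σ, h σ ∂ν| ≤ C := by
    intro h C hh
    have := norm_integral_le_of_norm_le_const (μ := ν) (f := h) (C := C)
      (Eventually.of_forall fun σ => by rw [Real.norm_eq_abs]; exact hh σ)
    simpa using this
  have h1 : |∫ σ, f σ * g σ ∂ν| ≤ CA * CB := key fun σ => by
    rw [abs_mul]
    exact mul_le_mul (hfb σ) (hgb σ) (abs_nonneg _) ((abs_nonneg _).trans (hfb σ))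
  have h2 : |∫ σ, f σ ∂ν| ≤ CA := key hfb
  have h3 : |∫ σ, g σ ∂ν| ≤ CB := key hgb
  calc |(∫ σ, f σ * g σ ∂ν) - (∫ σ, f σ ∂ν) * ∫ σ, g σ ∂ν|
      ≤ |∫ σ, f σ * g σ ∂ν| + |(∫ σ, f σ ∂ν) * ∫ σ, g σ ∂ν| := abs_sub _ _
    _ = |∫ σ, f σ * g σ ∂ν| + |∫ σ, f σ ∂ν| * |∫ σ, g σ ∂ν| := by rw [abs_mul]
    _ ≤ CA * CB + CA * CB :=
        add_le_add h1 (mul_le_mul h2 h3 (abs_nonneg _) ((abs_nonneg _).trans h2))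
    _ = 2 * (CA * CB) := by ring

/-! ### §D The far case: the tower identity and the engine -/

/-- **Far case, abstractly.** For a specification `γ` on a finite site set read on cells with the KR window
package (radius `n₀`), a Gibbs measure `ν`, and two bounded measurable observables `f`, `g` supported in
single cells `c_A`, `c_B` at coarse distance `≥ 2n₀ + 3`: the TOWER identity
`∫ f g dν − ∫ f dν ∫ g dν = cov(γ_{W_A} f, γ_{W_B} g)` (DLR for functions + pull-out of outside factors, from
`SpecificationTower`; `γ_{W_A} f` is a function of the shell of `W_A` by `IsKRWindow.range`), followed by the
ENGINE applied to the two window averages with their shell-supported cell-Lipschitz bounds: the connected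
correlation is at most `C₀ K_A K_B e^{-κ (cdist c_A c_B − 2n₀ − 2)}`. -/
theorem abs_corr_le_far {μ : Fin 4 → ℕ} {V S : Type} [Fintype V] [MeasurableSpace S]
    (hT : SpecificationTower) {n₀ : ℕ} {γ₀ R κ C₀ : ℝ} (hC₀ : 0 ≤ C₀)
    (hEng : ∀ (μ : Fin 4 → ℕ) (V S : Type) [Fintype V] [MeasurableSpace S]
      (cell : V → CoarseIdx μ) (w : CoarseIdx μ → (V → S) → (V → S) → ℝ)
      (γ : Specification V S) (k : CoarseIdx μ → CoarseIdx μ → CoarseIdx μ → ℝ),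
      (∀ i, 2 * n₀ + 3 ≤ μ i + 1) → IsSpecification γ → IsKRWindow cell w γ R n₀ γ₀ k →
      ∀ ν : Measure (V → S), IsGibbsMeasure γ ν →
      ∀ (f g : (V → S) → ℝ) (Δf Δg : Finset (CoarseIdx μ)) (δf δg : CoarseIdx μ → ℝ) (D : ℕ),
        Measurable f → Measurable g → (∃ B, ∀ σ, |f σ| ≤ B) → (∃ B, ∀ σ, |g σ| ≤ B) →
        DependsOn f {v | cell v ∈ Δf} → DependsOn g {v | cell v ∈ Δg} →
        IsCellLipBound cell w f δf → IsCellLipBound cell w g δg →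
        (∀ x ∈ Δf, ∀ y ∈ Δg, D ≤ cdist x y) →
          |cov[f, g; ν]| ≤ C₀ * (∑ x ∈ Δf, δf x) * (∑ y ∈ Δg, δg y) * Real.exp (-(κ * D)))
    (cell : V → CoarseIdx μ) (w : CoarseIdx μ → (V → S) → (V → S) → ℝ) (γ : Specification V S)
    (kp : CoarseIdx μ → CoarseIdx μ → CoarseIdx μ → ℝ)
    (hμ : ∀ i, 2 * n₀ + 3 ≤ μ i + 1) (hγ : IsSpecification γ) (hKR : IsKRWindow cell w γ R n₀ γ₀ kp)
    (ν : Measure (V → S)) (hν : IsGibbsMeasure γ ν)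
    {f g : (V → S) → ℝ} {CA CB : ℝ} (hfm : Measurable f) (hgm : Measurable g)
    (hfb : ∀ σ, |f σ| ≤ CA) (hgb : ∀ σ, |g σ| ≤ CB)
    {cA cB : CoarseIdx μ} (hfdep : DependsOn f {v | cell v = cA}) (hgdep : DependsOn g {v | cell v = cB})
    (hfar : 2 * n₀ + 3 ≤ cdist cA cB)
    {δA δB : CoarseIdx μ → ℝ} {KA KB : ℝ}
    (hLipA : IsCellLipBound cell w (windowAvg γ (windowVol cell n₀ cA) f) δA)
    (hLipB : IsCellLipBound cell w (windowAvg γ (windowVol cell n₀ cB) g) δB)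
    (hSA : ∑ y ∈ Finset.univ.filter (fun y => cdist cA y = n₀ + 1), δA y ≤ KA)
    (hSB : ∑ y ∈ Finset.univ.filter (fun y => cdist cB y = n₀ + 1), δB y ≤ KB) :
    |(∫ σ, f σ * g σ ∂ν) - (∫ σ, f σ ∂ν) * ∫ σ, g σ ∂ν| ≤
      C₀ * KA * KB * Real.exp (-(κ * (cdist cA cB - (2 * n₀ + 2) : ℕ))) := by
  classical
  haveI : IsProbabilityMeasure ν := hν.1
  -- windows and shells
  set WA : Finset V := windowVol cell n₀ cA with hWA
  set WB : Finset V := windowVol cell n₀ cB with hWB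
  set shellA : Finset (CoarseIdx μ) := Finset.univ.filter (fun y => cdist cA y = n₀ + 1) with hshellA
  set shellB : Finset (CoarseIdx μ) := Finset.univ.filter (fun y => cdist cB y = n₀ + 1) with hshellB
  have memWA : ∀ v, v ∈ WA ↔ cdist cA (cell v) ≤ n₀ := fun v => by simp [hWA, windowVol]
  have memWB : ∀ v, v ∈ WB ↔ cdist cB (cell v) ≤ n₀ := fun v => by simp [hWB, windowVol]
  have memShellA : ∀ y, y ∈ shellA ↔ cdist cA y = n₀ + 1 := fun y => by simp [hshellA]
  have memShellB : ∀ y, y ∈ shellB ↔ cdist cB y = n₀ + 1 := fun y => by simp [hshellB]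
  -- the window-averaging toolkit
  obtain ⟨hfhm, hfhb, hfhdep, hpullA, hdlrA⟩ := hT V S γ hγ WA f CA hfm hfb
  obtain ⟨hghm, hghb, hghdep, hpullB, hdlrB⟩ := hT V S γ hγ WB g CB hgm hgb
  set fh : (V → S) → ℝ := windowAvg γ WA f with hfh
  set gh : (V → S) → ℝ := windowAvg γ WB g with hgh
  -- `f`, `g` are window-local
  have hfloc : DependsOn f {v | cdist cA (cell v) ≤ n₀} := hfdep.mono fun v hv => by
    have hv' : cell v = cA := hv
    show cdist cA (cell v) ≤ n₀
    rw [hv', cdist_self]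
    exact Nat.zero_le _
  have hgloc : DependsOn g {v | cdist cB (cell v) ≤ n₀} := hgdep.mono fun v hv => by
    have hv' : cell v = cB := hv
    show cdist cB (cell v) ≤ n₀
    rw [hv', cdist_self]
    exact Nat.zero_le _
  -- (b) the window averages are functions of the shells
  have shell_dep : ∀ (c : CoarseIdx μ) (φ : (V → S) → ℝ) (C : ℝ), Measurable φ → (∀ σ, |φ σ| ≤ C) →
      DependsOn φ {v | cdist c (cell v) ≤ n₀} →
      DependsOn (windowAvg γ (windowVol cell n₀ c) φ) ((↑(windowVol cell n₀ c) : Set V)ᶜ) →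
      DependsOn (windowAvg γ (windowVol cell n₀ c) φ)
        {v | cell v ∈ Finset.univ.filter (fun y => cdist c y = n₀ + 1)} := by
    intro c φ C hφm hφb hφloc hφdep σ τ hστ
    let σ₁ : V → S := fun v => if cdist c (cell v) ≤ n₀ then τ v else σ v
    have h1 : windowAvg γ (windowVol cell n₀ c) φ σ = windowAvg γ (windowVol cell n₀ c) φ σ₁ := by
      refine hφdep fun v hv => ?_
      have hv' : ¬ cdist c (cell v) ≤ n₀ := fun hle =>
        hv (Finset.mem_coe.2 (Finset.mem_filter.2 ⟨Finset.mem_univ _, hle⟩))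
      show σ v = (if cdist c (cell v) ≤ n₀ then τ v else σ v)
      rw [if_neg hv']
    have h2 : windowAvg γ (windowVol cell n₀ c) φ σ₁ = windowAvg γ (windowVol cell n₀ c) φ τ := by
      have hdep := dependsOn_of_cellwise cell (windowAvg γ (windowVol cell n₀ c) φ)
        (Finset.univ.filter fun y => n₀ + 1 < cdist c y)
        (fun y hy σ' τ' h' => hKR.range c y (by simpa using hy) σ' τ' h' φ hφm ⟨C, hφb⟩ hφloc)
      refine hdep fun v hv => ?_
      have hv' : cdist c (cell v) ≤ n₀ + 1 := by simpa using hv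
      by_cases hle : cdist c (cell v) ≤ n₀
      · show (if cdist c (cell v) ≤ n₀ then τ v else σ v) = τ v
        rw [if_pos hle]
      · have heq : cdist c (cell v) = n₀ + 1 := by omega
        show (if cdist c (cell v) ≤ n₀ then τ v else σ v) = τ v
        rw [if_neg hle]
        exact hστ v (by simpa using heq)
    exact h1.trans h2
  have hfhshell : DependsOn fh {v | cell v ∈ shellA} := shell_dep cA f CA hfm hfb hfloc hfhdep
  have hghshell : DependsOn gh {v | cell v ∈ shellB} := shell_dep cB g CB hgm hgb hgloc hghdep
  -- (c) the tower identity
  have hg_offA : DependsOn g ((↑WA : Set V)ᶜ) := hgdep.mono fun v hv => by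
    have hv' : cell v = cB := hv
    show v ∉ (↑WA : Set V)
    rw [Finset.mem_coe, memWA, hv']
    omega
  have hfh_offB : DependsOn fh ((↑WB : Set V)ᶜ) := hfhshell.mono fun v hv => by
    have hv' : cdist cA (cell v) = n₀ + 1 := (memShellA _).1 hv
    show v ∉ (↑WB : Set V)
    rw [Finset.mem_coe, memWB]
    intro hle
    have h3 := cdist_triangle cA (cell v) cB
    rw [cdist_comm (cell v) cB] at h3
    omega
  have hgf_b : ∀ σ, |g σ * f σ| ≤ CB * CA := fun σ => by
    rw [abs_mul]
    exact mul_le_mul (hgb σ) (hfb σ) (abs_nonneg _) ((abs_nonneg _).trans (hgb σ))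
  have hfhg_b : ∀ σ, |fh σ * g σ| ≤ CA * CB := fun σ => by
    rw [abs_mul]
    exact mul_le_mul (hfhb σ) (hgb σ) (abs_nonneg _) ((abs_nonneg _).trans (hfhb σ))
  have step1 : ∫ σ, f σ * g σ ∂ν = ∫ σ, g σ * fh σ ∂ν := by
    have hdlr := (hT V S γ hγ WA (fun σ => g σ * f σ) (CB * CA) (hgm.mul hfm) hgf_b).2.2.2.2 ν hν
    have hp : ∀ η, windowAvg γ WA (fun σ => g σ * f σ) η = g η * fh η :=
      hpullA g hgm ⟨CB, hgb⟩ hg_offA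
    simp_rw [hp] at hdlr
    rw [hdlr]
    exact integral_congr_ae (Eventually.of_forall fun σ => mul_comm _ _)
  have step2 : ∫ σ, g σ * fh σ ∂ν = ∫ σ, fh σ * gh σ ∂ν := by
    have hdlr := (hT V S γ hγ WB (fun σ => fh σ * g σ) (CA * CB) (hfhm.mul hgm) hfhg_b).2.2.2.2 ν hν
    have hp : ∀ η, windowAvg γ WB (fun σ => fh σ * g σ) η = fh η * gh η :=
      hpullB fh hfhm ⟨CA, hfhb⟩ hfh_offB
    simp_rw [hp] at hdlr
    rw [hdlr]
    exact integral_congr_ae (Eventually.of_forall fun σ => mul_comm _ _)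
  have step3 : ∫ σ, f σ ∂ν = ∫ σ, fh σ ∂ν := (hdlrA ν hν).symm
  have step4 : ∫ σ, g σ ∂ν = ∫ σ, gh σ ∂ν := (hdlrB ν hν).symm
  have hfh2 : MemLp fh 2 ν := MemLp.of_bound hfhm.aestronglyMeasurable CA
    (Eventually.of_forall fun σ => by rw [Real.norm_eq_abs]; exact hfhb σ)
  have hgh2 : MemLp gh 2 ν := MemLp.of_bound hghm.aestronglyMeasurable CB
    (Eventually.of_forall fun σ => by rw [Real.norm_eq_abs]; exact hghb σ)
  have hcov : cov[fh, gh; ν] = (∫ σ, fh σ * gh σ ∂ν) - (∫ σ, fh σ ∂ν) * ∫ σ, gh σ ∂ν :=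
    ProbabilityTheory.covariance_eq_sub hfh2 hgh2
  have htower : (∫ σ, f σ * g σ ∂ν) - (∫ σ, f σ ∂ν) * ∫ σ, g σ ∂ν = cov[fh, gh; ν] := by
    rw [hcov, step1, step2, step3, step4]
  -- (e) the engine
  have hD : ∀ x ∈ shellA, ∀ y ∈ shellB, cdist cA cB - (2 * n₀ + 2) ≤ cdist x y := by
    intro x hx y hy
    have hx' := (memShellA x).1 hx
    have hy' := (memShellB y).1 hy
    have h1 := cdist_triangle cA x y
    have h2 := cdist_triangle cA y cB
    rw [cdist_comm y cB] at h2
    omega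
  have hcovb := hEng μ V S cell w γ kp hμ hγ hKR ν hν fh gh shellA shellB δA δB
    (cdist cA cB - (2 * n₀ + 2)) hfhm hghm ⟨CA, hfhb⟩ ⟨CB, hghb⟩ hfhshell hghshell hLipA hLipB hD
  have hSA0 : 0 ≤ ∑ y ∈ shellA, δA y := Finset.sum_nonneg fun y _ => hLipA.nonneg y
  have hSB0 : 0 ≤ ∑ y ∈ shellB, δB y := Finset.sum_nonneg fun y _ => hLipB.nonneg y
  rw [htower]
  refine hcovb.trans (mul_le_mul_of_nonneg_right ?_ (Real.exp_pos _).le)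
  exact mul_le_mul (mul_le_mul_of_nonneg_left hSA hC₀) hSB hSB0 (mul_nonneg hC₀ (hSA0.trans hSA))

/-! ### §E One torus, one time separation -/


end

end Summit.QuantumFields.YangMills.Cruxes.LatticeGapOnTrajectory.OrbitKantorovichFiniteSize
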